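import Summits.RiemannHypothesis.RiemannHypothesis.Theorems.JensenLogBandCanaryEdges

/-!
# E-CANARY-128 — D3 file 9c/9: THE CANARY — assembly of `XiDerivDiscRealCanary128` from the checked certificate

RH-FREE. Puts together the certificate rows (`…CanaryCertRows`), their checked contract facts (`left/top/imag_pieceIneq`,
`axis_axisIneq` of `…CanaryCert`, computational), the per-edge step rules of `…CanaryEdges`, the list machinery of
`…CanaryLists`, structural checks of the lists by `native_decide` (chaining, endpoints, labels, `176` quarter turns,
axis order/alternation), `64·(128/log 128)² < 44600` (`Real.log_two_gt_d9`), the right half-plane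
(`LogBand.iteratedDeriv_xiSq_ne_zero_of_re_nonneg`) and theory g10's `CanaryAssembly`. MAIN RESULTS:
`xiDerivDiscRealCanary128_of_stepRule` (analytic contract as hypotheses) and — discharging it by rh-jensen-eng-4's
`…CanaryAnalytic.stepRule_of_pieceIneq` / `axisSign_of_axisIneq` — **THE CANARY**
`xiDerivDiscRealCanary128_of_ratioEncloses : RatioEncloses xiRatioBoxHi128 xiTaylorCoeffFrom128 → XiDerivDiscRealCanary128`
and its annulus form `xiDerivEdgeRealCanary128_of_ratioEncloses` (PLAN-ONLY line «E-CANARY-128»).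
Nothing here bears on the truth of RH.
-/

-- D-0017: the doubled namespace is by design.
set_option linter.dupNamespace false
set_option autoImplicit false

noncomputable section

namespace Summit.RiemannHypothesis.RiemannHypothesis.Theorems.JensenPolynomials.LogBand.Canary

open Summit.RiemannHypothesis.RiemannHypothesis.Theorems.JensenPolynomials.CoeffTable (Iv lk RatioEncloses)
open Summit.RiemannHypothesis.RiemannHypothesis.Theorems.JensenPolynomials.LogBand
  (iteratedDeriv_xiSq_ne_zero_of_re_nonneg)
open Literature.NumberTheory.LFunctions (xiSq xiTaylorCoeff)
open Literature.Analysis.Complex Complex Set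
open scoped Real ComplexConjugate

/-! ## The four segment lists of the certificate and their structural checks -/

/-- LEFT edge `x = −45018` (`2x = −90036`), `y` from `−44600` to `44600` (doubled `−89200 … 89200`). -/
def leftI : List ISeg := vLowerI leftRows leftCount ++ vUpperI leftRows leftCount
/-- RIGHT edge `x = 0`. -/
def rightI : List ISeg := vLowerI imagRows imagCount ++ vUpperI imagRows imagCount
/-- TOP edge `y = 44600`, `x` from `−45018` to `0`. -/
def topI : List ISeg := hTopI topRows topCount
/-- BOTTOM edge `y = −44600` (conjugate labels). -/
def botI : List ISeg := hBotI topRows topCount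

/-- Head label and tail labels of an integer segment list. -/
def headLabel (T : List ISeg) : ℕ := (T.headD (0, 0, 0)).2.2
/-- see `headLabel` -/
def tailLabels (T : List ISeg) : List ℕ := (T.drop 1).map fun g => g.2.2

/-- The junction total of the certificate in quarter turns (mirrors `certAnchorSum`). -/
def quarterTotal (bot right top left : List ISeg) : ℤ :=
  jumpSum (headLabel bot) (tailLabels bot)
    + jumpVal (lastLabel (headLabel bot) (tailLabels bot)) (headLabel right)
    + jumpSum (headLabel right) (tailLabels right)
    + jumpVal (lastLabel (headLabel right) (tailLabels right)) (lastLabel (headLabel top) (tailLabels top))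
    - jumpSum (headLabel top) (tailLabels top)
    + jumpVal (headLabel top) (lastLabel (headLabel left) (tailLabels left))
    - jumpSum (headLabel left) (tailLabels left)
    + jumpVal (headLabel left) (headLabel bot)

/-- Structural check 1: chaining and endpoints of the four edge lists. -/
theorem chains_ok :
    (chainedI (-89200) leftI && decide (lastI (-89200) leftI = 89200) &&
      chainedI (-89200) rightI && decide (lastI (-89200) rightI = 89200) &&
      chainedI (-90036) topI && decide (lastI (-90036) topI = 0) &&
      chainedI (-90036) botI && decide (lastI (-90036) botI = 0)) = true := by
  native_decide

/-- Structural check 2: the rows sit on their edges. -/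
theorem rows_on_edges :
    ((List.range leftCount).all (fun i => decide (rowA leftRows i = -90036)) &&
      (List.range imagCount).all (fun i => decide (rowA imagRows i = 0)) &&
      (List.range topCount).all (fun i => decide (rowB topRows i = 89200))) = true := by
  native_decide

/-- Structural check 3: the lists are nonempty. -/
theorem lists_ne_nil : leftI ≠ [] ∧ rightI ≠ [] ∧ topI ≠ [] ∧ botI ≠ [] := by
  refine ⟨?_, ?_, ?_, ?_⟩ <;> native_decide

/-- Structural check 4: the junction total is `176 = 4·44` quarter turns. -/
theorem quarterTotal_eq : quarterTotal botI rightI topI leftI = 176 := by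
  native_decide

/-- Structural check 5: the axis points increase inside `(−45018, 0)` and their labels alternate in `{0, 2}`. -/
theorem axis_ok :
    ((List.range 44).all (fun i => decide (axA axisRows i < axA axisRows (i + 1))) &&
      decide (-90036 < axA axisRows 0) && decide (axA axisRows 44 < 0) && decide (axisCount = 45) &&
      (List.range 44).all (fun i =>
        (decide (axD axisRows i = 0) && decide (axD axisRows (i + 1) = 2)) ||
          (decide (axD axisRows i = 2) && decide (axD axisRows (i + 1) = 0)))) = true := by
  native_decide

/-! ## From the lists to the anchored certificate -/

/-- A cons decomposition of a mapped nonempty list of segments, with the list facts it transports. -/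
theorem segList_cons {T : List ISeg} (hT : T ≠ []) :
    ∃ (e : ℝ) (L : List (ℝ × ℂ)), segList (T.map toSeg) = (e, I ^ headLabel T) :: L ∧
      (∀ y₀ : ℤ, apLast e L = ((lastI y₀ T : ℤ) : ℝ) / 2) ∧
      apLastAnchor (I ^ headLabel T) L = I ^ lastLabel (headLabel T) (tailLabels T) ∧
      (apJumps (I ^ headLabel T) L).im = (π / 2) * (jumpSum (headLabel T) (tailLabels T) : ℤ) := by
  obtain ⟨g, T', rfl⟩ := List.exists_cons_of_ne_nil hT
  obtain ⟨s, e, d⟩ := g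
  refine ⟨(e : ℝ) / 2, segList (T'.map toSeg), rfl, fun y₀ => ?_, ?_, ?_⟩
  · rw [apLast_segList, segLast_toSeg]; rfl
  · rw [apLastAnchor_segList, segLabels_toSeg]; rfl
  · rw [im_apJumps_segList, segLabels_toSeg]; rfl

/-- `64·(128/log 128)² < 44600` (so the disc of the canary lies inside the rectangle). -/
theorem canaryRadius_lt : 64 * ((128 : ℝ) / Real.log 128) ^ 2 < 44600 := by
  have h2 := Real.log_two_gt_d9
  have hlog : (4.852 : ℝ) < Real.log 128 := by
    rw [show (128 : ℝ) = 2 ^ 7 by norm_num, Real.log_pow]; push_cast; linarith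
  have hpos : 0 < Real.log 128 := by linarith
  have hq : (128 : ℝ) / Real.log 128 < 26.39 := by
    rw [div_lt_iff₀ hpos]; nlinarith
  have hq0 : 0 < (128 : ℝ) / Real.log 128 := by positivity
  nlinarith

/-- `176` quarter turns are `44` full turns: `(π/2)·176 < 2π·45`. -/
theorem quarterTurns_lt (Q : ℤ) (hQ : Q = 176) : (π / 2) * ((Q : ℤ) : ℝ) < 2 * Real.pi * ((44 : ℕ) + 1) := by
  rw [hQ]
  have hpi := Real.pi_pos
  push_cast
  nlinarith

/-- **The canary from the checked certificate**, given the two analytic contract lemmas. RH-FREE; computational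
(`Lean.ofReduceBool` through `…CanaryCert`); CONDITIONAL on the ONE enclosure hypothesis
`RatioEncloses xiRatioBoxHi128 xiTaylorCoeffFrom128` — certified numerics, NOT a kernel fact. PROVENANCE of that
hypothesis (director-rh R2): `xiRatioBoxHi128 = mkBox 240 (xiRatioCentresHi128A ++ xiRatioCentresHi128B)`, i.e.
`(c_m − 1)/10²⁴⁰ ≤ γ(m+1)/γ(m) ≤ (c_m + 1)/10²⁴⁰` for `m = 128 … 1151`; every such interval CONTAINS the certified ratio
interval of EACH of FOUR ball tables — two code-disjoint lineages (L1 = Csordas–Norfolk–Varga `Φ`-moments, L2 = GORZ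
log-Mellin) at two precisions (Arb 2560-bit, `HOME/rh-jensen/eng/g7/gammahp/C1,C2`; Arb 1024-bit, `eng/gamma/L1,L2` =
the tables behind `XiTaylorRatioCentresA/B/C`), the four pairwise intersecting at every `m`, containment re-checked per
table and per `m` in exact rationals (0 violations in 4 096 checks, min slack 0.5006 ulp; `eng/g8/canary/boxhi`); data
files `Literature/…/XiTaylorRatioCentresHi128A.lean` (p501186, sha16 0205af11ca68ce8b) and `…B.lean` (p501226,
sha16 b3e6424295b63196). Nothing else rides in the hypothesis: the zeros, pieces, labels and axis signs are CHECKED by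
`native_decide`, not assumed. Independent replay of the certificate: rh-jensen-eng-4 D2 (kit j270735, own code) AGREES
(`N_K = 44 = m`). -/
theorem xiDerivDiscRealCanary128_of_stepRule (hstep : StepRuleContract) (haxis : AxisContract)
    (hbox : RatioEncloses xiRatioBoxHi128 xiTaylorCoeffFrom128) : XiDerivDiscRealCanary128 := by
  -- structural facts
  have hc := chains_ok
  simp only [Bool.and_eq_true, decide_eq_true_eq] at hc
  obtain ⟨⟨⟨⟨⟨⟨⟨hcL, hlL⟩, hcR⟩, hlR⟩, hcT⟩, hlT⟩, hcB⟩, hlB⟩ := hc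
  have hr := rows_on_edges
  simp only [Bool.and_eq_true, List.all_eq_true, List.mem_range, decide_eq_true_eq] at hr
  obtain ⟨⟨hrowL, hrowR⟩, hrowT⟩ := hr
  obtain ⟨hneL, hneR, hneT, hneB⟩ := lists_ne_nil
  -- contract facts per row
  have hPL : ∀ i, i < leftCount → PieceIneq (rowA leftRows i) (rowB leftRows i) (rowL leftRows i) (rowD leftRows i)
      (rowK leftRows i) (rowN leftRows i) certJ (rowX leftRows i) := fun i hi => left_pieceIneq hbox hi
  have hPT : ∀ i, i < topCount → PieceIneq (rowA topRows i) (rowB topRows i) (rowL topRows i) (rowD topRows i)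
      (rowK topRows i) (rowN topRows i) certJ (rowX topRows i) := fun i hi => top_pieceIneq hbox hi
  have hPR : ∀ i, i < imagCount → PieceIneq (rowA imagRows i) (rowB imagRows i) (rowL imagRows i) (rowD imagRows i)
      (rowK imagRows i) (rowN imagRows i) certJ (rowX imagRows i) := fun i hi => imag_pieceIneq hbox hi
  -- the four valid piece lists
  have e45018 : (((-90036 : ℤ) : ℝ)) / 2 = -45018 := by norm_num
  have e44600 : (((-89200 : ℤ) : ℝ)) / 2 = -44600 := by norm_num
  have e44600' : (((89200 : ℤ) : ℝ)) / 2 = 44600 := by norm_num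
  have e0 : (((0 : ℤ) : ℝ)) / 2 = 0 := by norm_num
  have hVL : VAPieces canaryF (-45018) (-44600) (segList (leftI.map toSeg)) := by
    rw [← e44600]
    refine vaPieces_segList _ _ (chained_toSeg _ _ hcL) (fun g hg => ⟨le_of_chainedI' _ _ hcL g hg, ?_⟩)
    rw [leftI, List.map_append, List.mem_append] at hg
    rw [← e45018]
    rcases hg with hg | hg
    · exact stepRule_vLower hstep hrowL hPL g hg
    · exact stepRule_vUpper hstep hrowL hPL g hg
  have hVR : VAPieces canaryF 0 (-44600) (segList (rightI.map toSeg)) := by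
    rw [← e44600]
    refine vaPieces_segList _ _ (chained_toSeg _ _ hcR) (fun g hg => ⟨le_of_chainedI' _ _ hcR g hg, ?_⟩)
    rw [rightI, List.map_append, List.mem_append] at hg
    rcases hg with hg | hg
    · simpa using stepRule_vLower hstep hrowR hPR g hg
    · simpa using stepRule_vUpper hstep hrowR hPR g hg
  have hHT : HAPieces canaryF 44600 (-45018) (segList (topI.map toSeg)) := by
    rw [← e45018]
    refine haPieces_segList _ _ (chained_toSeg _ _ hcT) (fun g hg => ⟨le_of_chainedI' _ _ hcT g hg, ?_⟩)
    rw [topI] at hg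
    rw [← e44600']
    exact stepRule_hTop hstep hrowT hPT g hg
  have hHB : HAPieces canaryF (-44600) (-45018) (segList (botI.map toSeg)) := by
    rw [← e45018]
    refine haPieces_segList _ _ (chained_toSeg _ _ hcB) (fun g hg => ⟨le_of_chainedI' _ _ hcB g hg, ?_⟩)
    rw [botI] at hg
    rw [show (-44600 : ℝ) = -((((89200 : ℤ) : ℝ)) / 2) by norm_num]
    exact stepRule_hBot hstep hrowT hPT g hg
  -- cons decompositions
  obtain ⟨xB, LB, hBcons, hlastB, hancB, hjB⟩ := segList_cons hneB
  obtain ⟨yR, LR, hRcons, hlastR, hancR, hjR⟩ := segList_cons hneR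
  obtain ⟨xT, LT, hTcons, hlastT, hancT, hjT⟩ := segList_cons hneT
  obtain ⟨yL, LL, hLcons, hlastL, hancL, hjL⟩ := segList_cons hneL
  set dB := headLabel botI with hdB
  set dR := headLabel rightI with hdR
  set dT := headLabel topI with hdT
  set dL := headLabel leftI with hdL
  rw [hBcons] at hHB; rw [hRcons] at hVR; rw [hTcons] at hHT; rw [hLcons] at hVL
  have hBe : apLast xB LB = 0 := by rw [hlastB (-90036), hlB]; norm_num
  have hRe : apLast yR LR = 44600 := by rw [hlastR (-89200), hlR]; norm_num
  have hTe : apLast xT LT = 0 := by rw [hlastT (-90036), hlT]; norm_num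
  have hLe : apLast yL LL = 44600 := by rw [hlastL (-89200), hlL]; norm_num
  -- the junction sum
  have him_eq : (certAnchorSum (I ^ dB) LB (I ^ dR) LR (I ^ dT) LT (I ^ dL) LL).im
      = (π / 2) * ((quarterTotal botI rightI topI leftI : ℤ) : ℝ) := by
    unfold certAnchorSum quarterTotal
    simp only [Complex.add_im, Complex.sub_im, hjB, hjR, hjT, hjL, hancB, hancR, hancT, hancL, im_anchorJump_I_pow,
      Int.cast_add, Int.cast_sub, ← hdB, ← hdR, ← hdT, ← hdL]
    ring
  have him : (certAnchorSum (I ^ dB) LB (I ^ dR) LR (I ^ dT) LT (I ^ dL) LL).im < 2 * Real.pi * ((44 : ℕ) + 1) := by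
    rw [him_eq]; exact quarterTurns_lt _ quarterTotal_eq
  -- the axis
  have hax := axis_ok
  simp only [Bool.and_eq_true, Bool.or_eq_true, List.all_eq_true, List.mem_range, decide_eq_true_eq] at hax
  obtain ⟨⟨⟨⟨hinc, hfirst⟩, hlast⟩, _⟩, halt⟩ := hax
  let t : Fin (44 + 1) → ℝ := fun j => ((axA axisRows j : ℤ) : ℝ) / 2
  have ht : StrictMono t := by
    refine Fin.strictMono_iff_lt_succ.2 fun j => ?_
    show ((axA axisRows j.castSucc : ℤ) : ℝ) / 2 < ((axA axisRows j.succ : ℤ) : ℝ) / 2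
    have := hinc j.val j.isLt
    have : ((axA axisRows j : ℤ) : ℝ) < ((axA axisRows (j + 1) : ℤ) : ℝ) := by exact_mod_cast this
    simpa using (by linarith : ((axA axisRows j : ℤ) : ℝ) / 2 < ((axA axisRows (j + 1) : ℤ) : ℝ) / 2)
  have hta : (-45018 : ℝ) < t 0 := by
    show (-45018 : ℝ) < ((axA axisRows 0 : ℤ) : ℝ) / 2
    have : ((-90036 : ℤ) : ℝ) < ((axA axisRows 0 : ℤ) : ℝ) := by exact_mod_cast hfirst
    push_cast at this
    linarith
  have htb : t (Fin.last 44) < 0 := by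
    show ((axA axisRows 44 : ℤ) : ℝ) / 2 < 0
    have : ((axA axisRows 44 : ℤ) : ℝ) < 0 := by exact_mod_cast hlast
    linarith
  have hsign : ∀ (i : ℕ) (hi : i < 45), (axD axisRows i = 0 → 0 < (canaryF (t ⟨i, by omega⟩)).re) ∧
      (axD axisRows i = 2 → (canaryF (t ⟨i, by omega⟩)).re < 0) := by
    intro i hi
    have hA := haxis _ _ _ _ (axis_axisIneq hbox (by rw [show axisCount = 45 from rfl]; exact hi))
    rw [pieceCentre_real] at hA
    constructor
    · intro h0; rw [h0, pow_zero, div_one] at hA; exact hA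
    · intro h2
      rw [h2, pow_two, Complex.I_mul_I, div_neg, div_one, Complex.neg_re] at hA
      linarith
  have halt' : ∀ j : Fin 44, (canaryF (t j.castSucc)).re * (canaryF (t j.succ)).re < 0 := by
    intro j
    have hj := halt j.val j.isLt
    have h0 := hsign j.val (by omega)
    have h1 := hsign (j.val + 1) (by omega)
    have ec : t j.castSucc = t ⟨j.val, by omega⟩ := rfl
    have es : t j.succ = t ⟨j.val + 1, by omega⟩ := rfl
    rw [ec, es]
    rcases hj with ⟨ha, hb⟩ | ⟨ha, hb⟩
    · exact mul_neg_of_pos_of_neg (h0.1 ha) (h1.2 hb)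
    · exact mul_neg_of_neg_of_pos (h0.2 ha) (h1.1 hb)
  -- analytic inputs
  have hf : AnalyticOnNhd ℂ canaryF (Icc (-45018 : ℝ) 0 ×ℂ Icc (-44600 : ℝ) 44600) :=
    fun z _ => differentiable_canaryF.analyticAt z
  -- assembly
  have key := CanaryAssembly.im_eq_zero_of_anchored_certificate_of_alternation (f := canaryF)
    (by norm_num : (-45018 : ℝ) < 0) (by norm_num : (-44600 : ℝ) < 0) (by norm_num : (0 : ℝ) < 44600) hf
    hHB hBe hVR hRe hHT hTe hVL hLe canaryF_im_ofReal t ht hta htb halt' him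
  -- conclusion
  intro z hz hnorm
  have hzero : canaryF z = 0 := (canaryF_eq_zero_iff z).2 hz
  by_cases hre : 0 ≤ z.re
  · exact absurd hz (iteratedDeriv_xiSq_ne_zero_of_re_nonneg 128 hre)
  · have hR := canaryRadius_lt
    have h1 : |z.re| ≤ ‖z‖ := Complex.abs_re_le_norm z
    have h2 : |z.im| ≤ ‖z‖ := Complex.abs_im_le_norm z
    rw [abs_le] at h1 h2
    refine key z ⟨⟨by linarith, not_le.1 hre⟩, ⟨by linarith, by linarith⟩⟩ hzero

/-- The annulus form, from the disc form. -/
theorem xiDerivEdgeRealCanary128_of_stepRule (hstep : StepRuleContract) (haxis : AxisContract)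
    (hbox : RatioEncloses xiRatioBoxHi128 xiTaylorCoeffFrom128) : XiDerivEdgeRealCanary128 :=
  canary_of_disc (xiDerivDiscRealCanary128_of_stepRule hstep haxis hbox)

/-! ## THE CANARY (line «E-CANARY-128») -/

/-- **E-CANARY-128 — the kernel canary, disc form.** Under the ONE enclosure hypothesis
`RatioEncloses xiRatioBoxHi128 xiTaylorCoeffFrom128` (certified numerics of two code-disjoint lineages at two
precisions, see `xiDerivDiscRealCanary128_of_stepRule` for the provenance; NOT a kernel fact), every zero `z` of
`ξ₁⁽¹²⁸⁾ = iteratedDeriv 128 xiSq` with `‖z‖ ≤ 64·(128/log 128)²` is REAL. RH-FREE; COMPUTATIONAL (`Lean.ofReduceBool`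
via `…CanaryCert` and the structural checks of this file); every analytic input is a tree theorem (the contract lemmas
`…CanaryAnalytic.stepRule_of_pieceIneq`, `axisSign_of_axisIneq` of rh-jensen-eng-4; theory g10's `CanaryAssembly`;
`LogBand.iteratedDeriv_xiSq_conj`, `LogBand.iteratedDeriv_xiSq_ne_zero_of_re_nonneg`). Certificate of record: cell
rh-jensen eng g8, kit j268994 (`HOME/eng/g8/ECANARY-D1.md`), independently replayed by eng-4 (D2, kit j270735, AGREE
`N_K = 44 = m`). -/
theorem xiDerivDiscRealCanary128_of_ratioEncloses (hbox : RatioEncloses xiRatioBoxHi128 xiTaylorCoeffFrom128) :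
    XiDerivDiscRealCanary128 :=
  xiDerivDiscRealCanary128_of_stepRule stepRule_of_pieceIneq axisSign_of_axisIneq hbox

/-- **E-CANARY-128 — the kernel canary, annulus form** (the `n = 128` instance of `JensenLogBand.XiDerivEdgeReal`),
under the same enclosure hypothesis. RH-FREE; COMPUTATIONAL. -/
theorem xiDerivEdgeRealCanary128_of_ratioEncloses (hbox : RatioEncloses xiRatioBoxHi128 xiTaylorCoeffFrom128) :
    XiDerivEdgeRealCanary128 :=
  canary_of_disc (xiDerivDiscRealCanary128_of_ratioEncloses hbox)

end Summit.RiemannHypothesis.RiemannHypothesis.Theorems.JensenPolynomials.LogBand.Canary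

end
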